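import Mathlib
import Summits.AtomisticToContinuum.HydrodynamicLimit.Theorems.ImplosionDichotomyDenseExcursionR2Profile

/-!
# The profile equations in original form and the gauge mode `Λ = r` of `SS(r₂)`
# (crux `DenseExcursion`, line `r2-one-mode-two-conditions`, stubs `stub_profileEqs`, `gauge_isSmoothRadialMode`)

Helper file (`--supports stmt-AtomisticToContinuum-12586`) for the line `r2-one-mode-two-conditions` (v4
skeleton) of the crux `Summit.AtomisticToContinuum.HydrodynamicLimit.Theses.ImplosionDichotomy.DenseExcursion`:

* `stub_profileEqs`: the Buckmaster–Cao-Labora–Gómez-Serrano profile of `stub_profile` (`…R2Profile.lean`, same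
  witnesses `r`, `W = wOf U`, `S = sOf S_BCG`) ALSO satisfies the radial momentum and mass equations in ORIGINAL
  (unsolved) form `(W-1)W′ + 3SS′ = rW - W² - 3S²`, `(1-W)S′ - (S/3)W′ = S(2W - r)` at every `x` — they are
  (BCG eq. 1)/`ζ` and (BCG eq. 2)/`(3ζ)` at `ζ = eˣ`; the `Δ`-solved form inside `IsMonatomicProfile` is their
  consequence (`solved_form_of_profileEqs`) but is silent on a would-be sonic plateau (v4 reshape);
* the line-posited definitions `linW`, `linS`, `IsRegularPair`, `IsSmoothRadialMode`, COPIED VERBATIM from the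
  skeleton's §0 (statements transfer by `Iff.rfl`);
* `gauge_isSmoothRadialMode`: for every monatomic profile satisfying the original-form equations, the blow-up-time
  shift `(ŵ, ŝ) = (W′ + rW, S′ + rS)` is a smooth centre-regular radial mode with eigenvalue `Λ = r` — the
  `Λ = (r : ℂ)` branch allowed by the exclusivity clause of `OneModeTwoConditions`. Eigen-identities: differentiate
  the equations once and combine (adapted from the disprover's `R2Line.lin_gauge_mode`, Cruxes work file
  `DenseExcursion/Disproof.lean` §12). Non-triviality: `S′ + rS ≡ 0` would give `S = S(0)e^{-rx}`, so the sound-speed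
  field `‖y‖ S(log ‖y‖) = S(0)‖y‖^{1-r}` would blow up at the centre (`r > 1`), contradicting its continuous
  extension `G`. Centre regularity: Euler's identity along rays (`F′(y)y = F y + W′(log ‖y‖) y`, same for `G`).

Sources: Buckmaster–Cao-Labora–Gómez-Serrano 2025 Thm 1.1 (`γ = 5/3`); Biasi 2021 §2–3, Merle–Raphaël–Rodnianski–Szeftel
2022 (symmetry modes). NOT here: the unstable mode `Λ₁` and the exclusivity clause (`stub_spectralPackage`).
-/

noncomputable section

open Set Filter Topology
open scoped ContDiff

namespace Summit.AtomisticToContinuum.HydrodynamicLimit.Theorems.R2OneModeTwoConditions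

open Literature.MathematicalPhysics.KineticTheory (V3)
open Summit.AtomisticToContinuum.HydrodynamicLimit.Theorems.KidderKnobMelnikov
  (norm_smul_unitVec differentiableAt_of_radialScalar differentiableAt_of_radialField)

/-! ## Stub `stub_profileEqs`: the profile equations in original form for the BCG profile -/

/-- THE PROFILE EQUATIONS IN ORIGINAL FORM. If `U, S` solve the BCG profile system at `ζ = eˣ > 0`, then
`W = wOf U`, `S = sOf S` satisfy the momentum equation `(W-1)W' + 3SS' = rW - W² - 3S²` ((BCG eq. 1)/`ζ`) and
the mass equation `(1-W)S' - (S/3)W' = S(2W - r)` ((BCG eq. 2)/`(3ζ)`) at `x`. [folklore] -/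
theorem origProfileEqs_of_bcg {r : ℝ} {U S : ℝ → ℝ} {x : ℝ}
    (hU : DifferentiableAt ℝ U (Real.exp x)) (hS : DifferentiableAt ℝ S (Real.exp x))
    (h1 : (r - 1) * U (Real.exp x) + (Real.exp x + U (Real.exp x)) * deriv U (Real.exp x) +
        1 / 3 * S (Real.exp x) * deriv S (Real.exp x) = 0)
    (h2 : (r - 1) * S (Real.exp x) + (Real.exp x + U (Real.exp x)) * deriv S (Real.exp x) +
        1 / 3 * S (Real.exp x) * (deriv U (Real.exp x) + 2 * U (Real.exp x) / Real.exp x) = 0) :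
    (wOf U x - 1) * deriv (wOf U) x + 3 * sOf S x * deriv (sOf S) x =
        r * wOf U x - wOf U x ^ 2 - 3 * sOf S x ^ 2 ∧
      (1 - wOf U x) * deriv (sOf S) x - sOf S x / 3 * deriv (wOf U) x = sOf S x * (2 * wOf U x - r) := by
  have hζ : Real.exp x ≠ 0 := (Real.exp_pos x).ne'
  rw [deriv_wOf hU, deriv_sOf hS]
  simp only [wOf, sOf]
  constructor
  · -- momentum = (BCG eq. 1)/ζ
    field_simp
    linear_combination (3 * Real.exp x) * h1
  · -- mass = (BCG eq. 2)/(3ζ)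
    field_simp
    linear_combination (3 * Real.exp x) * h2 - 2 * U (Real.exp x) * S (Real.exp x) * mul_inv_cancel₀ hζ

/-- THE WITNESS CONSTRUCTION OF `stub_profile`, EXPOSED: from the data `(r, U, S_BCG)` of the named fact
`BuckmasterCaolaboraGomezserrano2025_thm11_monatomic`, the change of variables `W = wOf U`, `S = sOf S_BCG` is a
monatomic profile (proof = the body of `stub_profile`). [cite: BuckmasterCaolaboraGomezserrano2025, Thm 1.1] -/
theorem isMonatomicProfile_wOf_sOf {r : ℝ} {U S : ℝ → ℝ} (hr₃ : 1.10102 < r) (hr₄ : r < 1.13476)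
    (hU3 : ContDiff ℝ ∞ (fun y : V3 => (U ‖y‖ / ‖y‖) • y)) (hS3 : ContDiff ℝ ∞ (fun y : V3 => S ‖y‖))
    (hode : ∀ ζ : ℝ, 0 < ζ →
      (r - 1) * U ζ + (ζ + U ζ) * deriv U ζ + 1 / 3 * S ζ * deriv S ζ = 0 ∧
      (r - 1) * S ζ + (ζ + U ζ) * deriv S ζ + 1 / 3 * S ζ * (deriv U ζ + 2 * U ζ / ζ) = 0)
    (hSpos : ∀ ζ : ℝ, 0 ≤ ζ → 0 < S ζ)
    (hUinf : Tendsto (fun ζ => U ζ / ζ) atTop (𝓝 0)) (hSinf : Tendsto (fun ζ => S ζ / ζ) atTop (𝓝 0)) :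
    IsMonatomicProfile r (wOf U) (sOf S) := by
  refine ⟨by linarith, ?_, contDiff_wOf hU3, contDiff_sOf hS3, ?_, ?_, ?_, ?_, ?_⟩
  · -- `r < 3 - √3`
    exact lt_trans (by linarith) window_lt_rStar
  · intro x -- `S > 0`
    have := hSpos (Real.exp x) (Real.exp_pos x).le
    simp only [sOf]
    positivity
  · intro x -- the profile equations (solved form)
    have hζ : 0 < Real.exp x := Real.exp_pos x
    obtain ⟨h1, h2⟩ := hode (Real.exp x) hζ
    exact profileEqs_of_bcg (differentiableAt_of_radialField hU3 hζ)
      (differentiableAt_of_radialScalar hS3 hζ) h1 h2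
  · -- centre regularity
    refine ⟨fun y => -((U ‖y‖ / ‖y‖) • y), fun y => S ‖y‖ / 3, hU3.neg, hS3.div_const 3, ?_, ?_⟩
    · have := hSpos ‖(0 : V3)‖ (norm_nonneg _)
      positivity
    · intro y hy
      have hy' : 0 < ‖y‖ := norm_pos_iff.2 hy
      simp only [wOf, sOf, Real.exp_log hy']
      refine ⟨?_, ?_⟩
      · rw [neg_div, neg_smul]
      · field_simp
  · -- far field, `W → 0`
    have h := (hUinf.comp Real.tendsto_exp_atTop).neg
    rw [neg_zero] at h
    refine h.congr fun x => ?_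
    simp only [Function.comp, wOf, neg_div]
  · -- far field, `S → 0`
    have h := (hSinf.comp Real.tendsto_exp_atTop).div_const 3
    rw [zero_div] at h
    refine h.congr fun x => ?_
    simp only [Function.comp, sOf]
    ring

/-- **Stub `stub_profileEqs` of line `r2-one-mode-two-conditions`: THE SMOOTH PROFILE WITH ITS EQUATIONS IN
ORIGINAL FORM.** From the named fact `Literature.Analysis.FluidPDE.BuckmasterCaolaboraGomezserrano2025_thm11_monatomic`
(BCG 2025 Thm 1.1 at `γ = 5/3`) by the change of variables `W(x) = -U(eˣ)/eˣ`, `S(x) = S_BCG(eˣ)/(3eˣ)` of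
`stub_profile` (same witnesses): a speed `11/10 < r < 227/200`, a profile `IsMonatomicProfile r W S`, and at every
`x` the radial momentum and mass equations `(W-1)W' + 3SS' = rW - W² - 3S²`, `(1-W)S' - (S/3)W' = S(2W - r)`.
[cite: BuckmasterCaolaboraGomezserrano2025, Thm 1.1] -/
theorem stub_profileEqs :
    Literature.Analysis.FluidPDE.BuckmasterCaolaboraGomezserrano2025_thm11_monatomic →
    ∃ (r : ℝ) (W S : ℝ → ℝ), (11 / 10 < r ∧ r < 227 / 200) ∧ IsMonatomicProfile r W S ∧
      ∀ x, (W x - 1) * deriv W x + 3 * S x * deriv S x = r * W x - W x ^ 2 - 3 * S x ^ 2 ∧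
        (1 - W x) * deriv S x - S x / 3 * deriv W x = S x * (2 * W x - r) := by
  rintro ⟨r, hr₃, hr₄, U, S, hU3, hS3, hode, hSpos, hUinf, hSinf⟩
  refine ⟨r, wOf U, sOf S, ⟨by linarith, by linarith⟩,
    isMonatomicProfile_wOf_sOf hr₃ hr₄ hU3 hS3 hode hSpos hUinf hSinf, fun x => ?_⟩
  have hζ : 0 < Real.exp x := Real.exp_pos x
  obtain ⟨h1, h2⟩ := hode (Real.exp x) hζ
  exact origProfileEqs_of_bcg (differentiableAt_of_radialField hU3 hζ)
    (differentiableAt_of_radialScalar hS3 hζ) h1 h2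

/-! ## The line-posited definitions (verbatim: skeleton `r2-one-mode-two-conditions.lean` v4, §0) -/


/-- Right-hand side (the `W`-component of the linearised operator `L`) of the radial isentropic Euler
system linearised in self-similar variables around the profile `(W, S)`, acting on a perturbation
`(ŵ, ŝ) : ℝ → ℂ²` (functions of `x = log y`): `(W - 1) ŵ' + 3 S ŝ' + (W' + 2 W - r) ŵ + (3 S' + 6 S) ŝ`. -/
def linW (r : ℝ) (W S : ℝ → ℝ) (ŵ ŝ : ℝ → ℂ) (x : ℝ) : ℂ :=
  ((W x - 1 : ℝ) : ℂ) * deriv ŵ x + ((3 * S x : ℝ) : ℂ) * deriv ŝ x +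
    ((deriv W x + 2 * W x - r : ℝ) : ℂ) * ŵ x + ((3 * deriv S x + 6 * S x : ℝ) : ℂ) * ŝ x

/-- The `S`-component of the linearised operator: `(S/3) ŵ' + (W - 1) ŝ' + (S' + 2 S) ŵ + (W'/3 + 2 W - r) ŝ`. -/
def linS (r : ℝ) (W S : ℝ → ℝ) (ŵ ŝ : ℝ → ℂ) (x : ℝ) : ℂ :=
  ((S x / 3 : ℝ) : ℂ) * deriv ŵ x + ((W x - 1 : ℝ) : ℂ) * deriv ŝ x +
    ((deriv S x + 2 * S x : ℝ) : ℂ) * ŵ x + ((deriv W x / 3 + 2 * W x - r : ℝ) : ℂ) * ŝ x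

/-- A smooth radial perturbation REGULAR AT THE CENTRE (v4 form, matching `IsMonatomicProfile`): `ŵ, ŝ` are
`C^∞` in `x = log y` and the real and imaginary parts of the radial fields `y ↦ ŵ(log ‖y‖) y` (velocity
direction field) and `y ↦ ‖y‖ ŝ(log ‖y‖)` (sound-speed perturbation) extend to `C^∞` fields on `ℝ³` — so that
`δu = -R ŵ/(r(T-t))`, `δc = R ŝ/(r(T-t))` are smooth radial fields; equivalently (Whitney) `ŵ`, `y ŝ` are smooth
functions of `y²`. -/
def IsRegularPair (ŵ ŝ : ℝ → ℂ) : Prop :=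
  ContDiff ℝ ∞ ŵ ∧ ContDiff ℝ ∞ ŝ ∧
    ∃ (F₁ F₂ : V3 → V3) (G₁ G₂ : V3 → ℝ),
      ContDiff ℝ ∞ F₁ ∧ ContDiff ℝ ∞ F₂ ∧ ContDiff ℝ ∞ G₁ ∧ ContDiff ℝ ∞ G₂ ∧
      ∀ y : V3, y ≠ 0 →
        (ŵ (Real.log ‖y‖)).re • y = F₁ y ∧ (ŵ (Real.log ‖y‖)).im • y = F₂ y ∧
        ‖y‖ * (ŝ (Real.log ‖y‖)).re = G₁ y ∧ ‖y‖ * (ŝ (Real.log ‖y‖)).im = G₂ y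

/-- A SMOOTH RADIAL (linear) MODE with growth rate `Λ ∈ ℂ` of the profile `(W, S)` (clock
`T - t = T e^{-rτ}`, perturbations `∝ e^{Λτ}`): a non-trivial centre-regular `C^∞` solution of
`Λ ŵ = linW`, `Λ ŝ = linS`. Smoothness across the sonic point excludes Biasi's continuum of
finitely-regular modes; `Λ = r` (blow-up time) and `Λ = 0` (scaling) are the symmetry modes. -/
def IsSmoothRadialMode (r : ℝ) (W S : ℝ → ℝ) (Λ : ℂ) (ŵ ŝ : ℝ → ℂ) : Prop :=
  IsRegularPair ŵ ŝ ∧ (∃ x, ŵ x ≠ 0 ∨ ŝ x ≠ 0) ∧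
    ∀ x, Λ * ŵ x = linW r W S ŵ ŝ x ∧ Λ * ŝ x = linS r W S ŵ ŝ x

/-! ## The gauge mode `Λ = r` -/

-- adapted from Cruxes/DenseExcursion/Disproof.lean §12 (`R2Line.profileEqs_deriv`; `C^∞` hypotheses)
/-- The two profile equations DIFFERENTIATED once (for `C^∞` profiles satisfying them everywhere). [folklore] -/
theorem profileEqs_deriv {r : ℝ} {W S : ℝ → ℝ} (hW : ContDiff ℝ ∞ W) (hS : ContDiff ℝ ∞ S)
    (hM : ∀ x, (W x - 1) * deriv W x + 3 * S x * deriv S x = r * W x - W x ^ 2 - 3 * S x ^ 2)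
    (hC : ∀ x, (1 - W x) * deriv S x - S x / 3 * deriv W x = S x * (2 * W x - r)) (x : ℝ) :
    (deriv W x * deriv W x + (W x - 1) * deriv (deriv W) x +
        (3 * deriv S x * deriv S x + 3 * S x * deriv (deriv S) x) =
      r * deriv W x - (deriv W x * W x + W x * deriv W x) - 3 * (deriv S x * S x + S x * deriv S x)) ∧
    (-deriv W x * deriv S x + (1 - W x) * deriv (deriv S) x -
        (deriv S x / 3 * deriv W x + S x / 3 * deriv (deriv W) x) =
      deriv S x * (2 * W x - r) + S x * (2 * deriv W x)) := by
  have hW1 : Differentiable ℝ W := hW.differentiable (by simp)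
  have hS1 : Differentiable ℝ S := hS.differentiable (by simp)
  have hW2 : Differentiable ℝ (deriv W) := (contDiff_infty_iff_deriv.1 hW).2.differentiable (by simp)
  have hS2 : Differentiable ℝ (deriv S) := (contDiff_infty_iff_deriv.1 hS).2.differentiable (by simp)
  have hMd : HasDerivAt (fun y => (W y - 1) * deriv W y + 3 * S y * deriv S y)
      (deriv W x * deriv W x + (W x - 1) * deriv (deriv W) x +
        (3 * deriv S x * deriv S x + 3 * S x * deriv (deriv S) x)) x := by
    have h1 : HasDerivAt (fun y => W y - 1) (deriv W x) x := (hW1 x).hasDerivAt.sub_const 1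
    have h2 : HasDerivAt (deriv W) (deriv (deriv W) x) x := (hW2 x).hasDerivAt
    have h3 : HasDerivAt (fun y => 3 * S y) (3 * deriv S x) x := (hS1 x).hasDerivAt.const_mul 3
    have h4 : HasDerivAt (deriv S) (deriv (deriv S) x) x := (hS2 x).hasDerivAt
    exact (h1.mul h2).add (h3.mul h4)
  have hMd' : HasDerivAt (fun y => r * W y - W y * W y - 3 * (S y * S y))
      (r * deriv W x - (deriv W x * W x + W x * deriv W x) - 3 * (deriv S x * S x + S x * deriv S x)) x := by
    have h1 : HasDerivAt (fun y => r * W y) (r * deriv W x) x := (hW1 x).hasDerivAt.const_mul r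
    have h2 : HasDerivAt (fun y => W y * W y) (deriv W x * W x + W x * deriv W x) x :=
      (hW1 x).hasDerivAt.mul (hW1 x).hasDerivAt
    have h3 : HasDerivAt (fun y => 3 * (S y * S y)) (3 * (deriv S x * S x + S x * deriv S x)) x :=
      ((hS1 x).hasDerivAt.mul (hS1 x).hasDerivAt).const_mul 3
    exact (h1.sub h2).sub h3
  have hCd : HasDerivAt (fun y => (1 - W y) * deriv S y - S y / 3 * deriv W y)
      (-deriv W x * deriv S x + (1 - W x) * deriv (deriv S) x -
        (deriv S x / 3 * deriv W x + S x / 3 * deriv (deriv W) x)) x := by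
    have h1 : HasDerivAt (fun y => 1 - W y) (-deriv W x) x := by
      simpa using (hW1 x).hasDerivAt.const_sub 1
    have h2 : HasDerivAt (deriv S) (deriv (deriv S) x) x := (hS2 x).hasDerivAt
    have h3 : HasDerivAt (fun y => S y / 3) (deriv S x / 3) x := (hS1 x).hasDerivAt.div_const 3
    have h4 : HasDerivAt (deriv W) (deriv (deriv W) x) x := (hW2 x).hasDerivAt
    exact (h1.mul h2).sub (h3.mul h4)
  have hCd' : HasDerivAt (fun y => S y * (2 * W y - r)) (deriv S x * (2 * W x - r) + S x * (2 * deriv W x)) x := by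
    have h1 : HasDerivAt (fun y => 2 * W y - r) (2 * deriv W x) x :=
      ((hW1 x).hasDerivAt.const_mul 2).sub_const r
    exact (hS1 x).hasDerivAt.mul h1
  have eM : (fun y => (W y - 1) * deriv W y + 3 * S y * deriv S y) =
      fun y => r * W y - W y * W y - 3 * (S y * S y) := funext fun y => by rw [hM y]; ring
  have eC : (fun y => (1 - W y) * deriv S y - S y / 3 * deriv W y) = fun y => S y * (2 * W y - r) :=
    funext hC
  constructor
  · rw [← hMd.deriv, ← hMd'.deriv, eM]
  · rw [← hCd.deriv, ← hCd'.deriv, eC]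

-- adapted from Cruxes/DenseExcursion/Disproof.lean §12 (`R2Line.lin_gauge_mode`; `C^∞` hypotheses)
/-- **GAUGE MODE `Λ = r`, THE EIGEN-IDENTITIES**: for `C^∞` profiles satisfying the two profile equations
everywhere, `(ŵ, ŝ) = (W' + rW, S' + rS)` is an eigenvector of the typed operator `(linW, linS)` with eigenvalue
`r` — the blow-up-time shift. [folklore] -/
theorem lin_gauge_mode {r : ℝ} {W S : ℝ → ℝ} (hW : ContDiff ℝ ∞ W) (hS : ContDiff ℝ ∞ S)
    (hM : ∀ x, (W x - 1) * deriv W x + 3 * S x * deriv S x = r * W x - W x ^ 2 - 3 * S x ^ 2)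
    (hC : ∀ x, (1 - W x) * deriv S x - S x / 3 * deriv W x = S x * (2 * W x - r)) (x : ℝ) :
    linW r W S (fun y => ((deriv W y + r * W y : ℝ) : ℂ)) (fun y => ((deriv S y + r * S y : ℝ) : ℂ)) x =
      (r : ℂ) * ((deriv W x + r * W x : ℝ) : ℂ) ∧
    linS r W S (fun y => ((deriv W y + r * W y : ℝ) : ℂ)) (fun y => ((deriv S y + r * S y : ℝ) : ℂ)) x =
      (r : ℂ) * ((deriv S x + r * S x : ℝ) : ℂ) := by
  have hW1 : Differentiable ℝ W := hW.differentiable (by simp)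
  have hS1 : Differentiable ℝ S := hS.differentiable (by simp)
  have hW2 : Differentiable ℝ (deriv W) := (contDiff_infty_iff_deriv.1 hW).2.differentiable (by simp)
  have hS2 : Differentiable ℝ (deriv S) := (contDiff_infty_iff_deriv.1 hS).2.differentiable (by simp)
  obtain ⟨dM, dC⟩ := profileEqs_deriv hW hS hM hC x
  have dŵ : deriv (fun y => ((deriv W y + r * W y : ℝ) : ℂ)) x = ((deriv (deriv W) x + r * deriv W x : ℝ) : ℂ) :=
    ((((hW2 x).hasDerivAt).add ((hW1 x).hasDerivAt.const_mul r)).ofReal_comp).deriv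
  have dŝ : deriv (fun y => ((deriv S y + r * S y : ℝ) : ℂ)) x = ((deriv (deriv S) x + r * deriv S x : ℝ) : ℂ) :=
    ((((hS2 x).hasDerivAt).add ((hS1 x).hasDerivAt.const_mul r)).ofReal_comp).deriv
  have dMc := congrArg (fun t : ℝ => (t : ℂ)) dM
  have dCc := congrArg (fun t : ℝ => (t : ℂ)) dC
  have hMc := congrArg (fun t : ℝ => (t : ℂ)) (hM x)
  have hCc := congrArg (fun t : ℝ => (t : ℂ)) (hC x)
  push_cast at dMc dCc hMc hCc
  unfold linW linS
  rw [dŵ, dŝ]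
  push_cast
  constructor
  · linear_combination dMc + 2 * (r : ℂ) * hMc
  · linear_combination (-1 : ℂ) * dCc - 2 * (r : ℂ) * hCc

/-- EULER'S IDENTITY ALONG RAYS for a radial direction field: if `F y = W(log ‖y‖) y` off the origin with `F`
differentiable, then `F'(y) y = F y + W'(log ‖y‖) y` for `y ≠ 0` (differentiate
`t ↦ F (t y) = (t W(log t + log ‖y‖)) y` at `t = 1`). [folklore] -/
theorem fderiv_apply_self_of_radialField {W : ℝ → ℝ} {F : V3 → V3} (hW : Differentiable ℝ W)
    (hF : Differentiable ℝ F) (hWF : ∀ y : V3, y ≠ 0 → W (Real.log ‖y‖) • y = F y) {y : V3} (hy : y ≠ 0) :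
    fderiv ℝ F y y = F y + deriv W (Real.log ‖y‖) • y := by
  have hy' : 0 < ‖y‖ := norm_pos_iff.2 hy
  have h1 : HasDerivAt (fun t : ℝ => F (t • y)) (fderiv ℝ F y y) 1 := by
    have h := (hF y).hasFDerivAt.comp_hasDerivAt_of_eq (1 : ℝ) ((hasDerivAt_id' (1 : ℝ)).smul_const y)
      (one_smul ℝ y).symm
    rw [one_smul] at h
    exact h
  have h2 : HasDerivAt (fun t : ℝ => (t * W (Real.log t + Real.log ‖y‖)) • y)
      ((W (Real.log ‖y‖) + deriv W (Real.log ‖y‖)) • y) 1 := by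
    have hl : HasDerivAt (fun t : ℝ => Real.log t + Real.log ‖y‖) (1 : ℝ)⁻¹ 1 :=
      (Real.hasDerivAt_log one_ne_zero).add_const _
    have hWl : HasDerivAt (fun t : ℝ => W (Real.log t + Real.log ‖y‖))
        (deriv W (Real.log 1 + Real.log ‖y‖) * (1 : ℝ)⁻¹) 1 := (hW _).hasDerivAt.comp (1 : ℝ) hl
    have h := ((hasDerivAt_id' (1 : ℝ)).mul hWl).smul_const y
    simpa [Real.log_one] using h
  have heq : (fun t : ℝ => F (t • y)) =ᶠ[𝓝 1] fun t => (t * W (Real.log t + Real.log ‖y‖)) • y := by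
    filter_upwards [Ioi_mem_nhds one_pos] with t ht
    have ht : 0 < t := ht
    rw [← hWF (t • y) (smul_ne_zero ht.ne' hy), norm_smul, Real.norm_of_nonneg ht.le,
      Real.log_mul ht.ne' hy'.ne', smul_smul, mul_comm]
  rw [h1.unique (h2.congr_of_eventuallyEq heq), add_smul, hWF y hy]

/-- EULER'S IDENTITY ALONG RAYS for a radial scalar field: if `G y = ‖y‖ S(log ‖y‖)` off the origin with `G`
differentiable, then `G'(y) y = G y + ‖y‖ S'(log ‖y‖)` for `y ≠ 0`. [folklore] -/
theorem fderiv_apply_self_of_radialScalar {S : ℝ → ℝ} {G : V3 → ℝ} (hS : Differentiable ℝ S)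
    (hG : Differentiable ℝ G) (hSG : ∀ y : V3, y ≠ 0 → ‖y‖ * S (Real.log ‖y‖) = G y) {y : V3} (hy : y ≠ 0) :
    fderiv ℝ G y y = G y + ‖y‖ * deriv S (Real.log ‖y‖) := by
  have hy' : 0 < ‖y‖ := norm_pos_iff.2 hy
  have h1 : HasDerivAt (fun t : ℝ => G (t • y)) (fderiv ℝ G y y) 1 := by
    have h := (hG y).hasFDerivAt.comp_hasDerivAt_of_eq (1 : ℝ) ((hasDerivAt_id' (1 : ℝ)).smul_const y)
      (one_smul ℝ y).symm
    rw [one_smul] at h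
    exact h
  have h2 : HasDerivAt (fun t : ℝ => t * (‖y‖ * S (Real.log t + Real.log ‖y‖)))
      (‖y‖ * S (Real.log ‖y‖) + ‖y‖ * deriv S (Real.log ‖y‖)) 1 := by
    have hl : HasDerivAt (fun t : ℝ => Real.log t + Real.log ‖y‖) (1 : ℝ)⁻¹ 1 :=
      (Real.hasDerivAt_log one_ne_zero).add_const _
    have hSl : HasDerivAt (fun t : ℝ => S (Real.log t + Real.log ‖y‖))
        (deriv S (Real.log 1 + Real.log ‖y‖) * (1 : ℝ)⁻¹) 1 := (hS _).hasDerivAt.comp (1 : ℝ) hl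
    have h : HasDerivAt (fun t : ℝ => t * (‖y‖ * S (Real.log t + Real.log ‖y‖)))
        (1 * (‖y‖ * S (Real.log 1 + Real.log ‖y‖)) +
          1 * (‖y‖ * (deriv S (Real.log 1 + Real.log ‖y‖) * (1 : ℝ)⁻¹))) 1 :=
      (hasDerivAt_id' (1 : ℝ)).mul (hSl.const_mul ‖y‖)
    simpa [Real.log_one] using h
  have heq : (fun t : ℝ => G (t • y)) =ᶠ[𝓝 1] fun t => t * (‖y‖ * S (Real.log t + Real.log ‖y‖)) := by
    filter_upwards [Ioi_mem_nhds one_pos] with t ht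
    have ht : 0 < t := ht
    rw [← hSG (t • y) (smul_ne_zero ht.ne' hy), norm_smul, Real.norm_of_nonneg ht.le,
      Real.log_mul ht.ne' hy'.ne', mul_assoc]
  rw [h1.unique (h2.congr_of_eventuallyEq heq), hSG y hy]

/-- NON-TRIVIALITY OF THE GAUGE MODE: `S' + r S` does not vanish identically when `r > 1`, `S(0) > 0` and the
sound-speed field `‖y‖ S(log ‖y‖)` extends continuously to the origin: otherwise `e^{rx} S(x)` is constant and
along `u ↦ e^{-u} e₀` the field equals `S(0) e^{(r-1)u} → ∞`, yet it tends to `G 0`. [folklore] -/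
theorem exists_gauge_ne_zero {r : ℝ} {S : ℝ → ℝ} {G : V3 → ℝ} (hr : 1 < r) (hS : Differentiable ℝ S)
    (hS0 : 0 < S 0) (hG : Continuous G) (hSG : ∀ y : V3, y ≠ 0 → ‖y‖ * S (Real.log ‖y‖) = G y) :
    ∃ x, deriv S x + r * S x ≠ 0 := by
  by_contra h
  simp only [ne_eq, not_exists, not_not] at h
  have hd : ∀ x, HasDerivAt (fun x => Real.exp (r * x) * S x) 0 x := by
    intro x
    have h1 : HasDerivAt (fun x => Real.exp (r * x)) (Real.exp (r * x) * r) x := by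
      simpa using ((hasDerivAt_id' x).const_mul r).exp
    have h2 : HasDerivAt (fun x => Real.exp (r * x) * S x)
        (Real.exp (r * x) * r * S x + Real.exp (r * x) * deriv S x) x := h1.mul (hS x).hasDerivAt
    refine h2.congr_deriv ?_
    calc Real.exp (r * x) * r * S x + Real.exp (r * x) * deriv S x
        = Real.exp (r * x) * (deriv S x + r * S x) := by ring
      _ = 0 := by rw [h x, mul_zero]
  have hconst : ∀ x, Real.exp (r * x) * S x = S 0 := by
    intro x
    have := is_const_of_deriv_eq_zero (fun x => (hd x).differentiableAt) (fun x => (hd x).deriv) x 0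
    simpa using this
  set e : V3 := EuclideanSpace.single 0 1
  have hGray : ∀ u : ℝ, G (Real.exp (-u) • e) = S 0 * Real.exp ((r - 1) * u) := by
    intro u
    have hne : Real.exp (-u) • e ≠ 0 :=
      norm_pos_iff.1 (by rw [norm_smul_unitVec (Real.exp_pos _).le]; exact Real.exp_pos _)
    have hexp : Real.exp (-u) = Real.exp (r * -u) * Real.exp ((r - 1) * u) := by
      rw [← Real.exp_add]; congr 1; ring
    rw [← hSG _ hne, norm_smul_unitVec (Real.exp_pos _).le, Real.log_exp, ← hconst (-u), hexp]
    ring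
  have hlim1 : Tendsto (fun u : ℝ => G (Real.exp (-u) • e)) atTop (𝓝 (G 0)) := by
    have h0 : Tendsto (fun u : ℝ => Real.exp (-u) • e) atTop (𝓝 0) := by
      simpa using Real.tendsto_exp_neg_atTop_nhds_zero.smul_const e
    exact (hG.tendsto 0).comp h0
  have hlim2 : Tendsto (fun u : ℝ => G (Real.exp (-u) • e)) atTop atTop := by
    have h3 : Tendsto (fun u : ℝ => S 0 * Real.exp ((r - 1) * u)) atTop atTop :=
      (Real.tendsto_exp_atTop.comp (tendsto_id.const_mul_atTop (sub_pos.2 hr))).const_mul_atTop hS0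
    exact h3.congr fun u => (hGray u).symm
  exact hlim1.not_tendsto (disjoint_nhds_atTop _) hlim2

/-- **Helper `gauge_isSmoothRadialMode` of line `r2-one-mode-two-conditions`: THE GAUGE MODE IS A SMOOTH RADIAL
MODE WITH `Λ = r`.** For every monatomic profile `IsMonatomicProfile r W S` satisfying the radial momentum and
mass equations in original form everywhere, the blow-up-time shift `(ŵ, ŝ) = (W' + rW, S' + rS)` is a smooth
centre-regular radial mode of the typed linearised operator with eigenvalue `Λ = (r : ℂ)`: eigen-identities by
`lin_gauge_mode`; centre regularity with the smooth fields `F₁ = F'(y)y - F y + r F y`, `G₁ = G'(y)y - G y + r G y`,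
`F₂ = G₂ = 0` (Euler's identity along rays); non-triviality by `exists_gauge_ne_zero`. This inhabits the
`Λ = (r : ℂ)` branch of the exclusivity clause of `OneModeTwoConditions`. [folklore] -/
theorem gauge_isSmoothRadialMode : ∀ {r : ℝ} {W S : ℝ → ℝ}, IsMonatomicProfile r W S →
    (∀ x, (W x - 1) * deriv W x + 3 * S x * deriv S x = r * W x - W x ^ 2 - 3 * S x ^ 2 ∧
      (1 - W x) * deriv S x - S x / 3 * deriv W x = S x * (2 * W x - r)) →
    IsSmoothRadialMode r W S (r : ℂ) (fun x => ((deriv W x + r * W x : ℝ) : ℂ))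
      (fun x => ((deriv S x + r * S x : ℝ) : ℂ)) := by
  intro r W S hP hEqs
  obtain ⟨hr1, -, hW, hS, hSpos, -, ⟨F, G, hF, hG, -, hFG⟩, -, -⟩ := hP
  have hW1 : Differentiable ℝ W := hW.differentiable (by simp)
  have hS1 : Differentiable ℝ S := hS.differentiable (by simp)
  have hF1 : Differentiable ℝ F := hF.differentiable (by simp)
  have hG1 : Differentiable ℝ G := hG.differentiable (by simp)
  refine ⟨⟨?_, ?_, ?_⟩, ?_, ?_⟩
  · -- `ŵ` is smooth
    exact Complex.ofRealCLM.contDiff.comp ((contDiff_infty_iff_deriv.1 hW).2.add (contDiff_const.mul hW))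
  · -- `ŝ` is smooth
    exact Complex.ofRealCLM.contDiff.comp ((contDiff_infty_iff_deriv.1 hS).2.add (contDiff_const.mul hS))
  · -- centre regularity
    refine ⟨fun y => fderiv ℝ F y y - F y + r • F y, fun _ => 0,
      fun y => fderiv ℝ G y y - G y + r * G y, fun _ => 0, ?_, contDiff_const, ?_, contDiff_const, ?_⟩
    · exact (((contDiff_infty_iff_fderiv.1 hF).2.clm_apply contDiff_id).sub hF).add (hF.const_smul r)
    · exact (((contDiff_infty_iff_fderiv.1 hG).2.clm_apply contDiff_id).sub hG).add (contDiff_const.mul hG)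
    · intro y hy
      obtain ⟨hFy, hGy⟩ := hFG y hy
      refine ⟨?_, ?_, ?_, ?_⟩
      · dsimp only
        rw [Complex.ofReal_re, fderiv_apply_self_of_radialField hW1 hF1 (fun z hz => (hFG z hz).1) hy, ← hFy,
          add_smul, smul_smul]
        abel
      · rw [Complex.ofReal_im, zero_smul]
      · dsimp only
        rw [Complex.ofReal_re, fderiv_apply_self_of_radialScalar hS1 hG1 (fun z hz => (hFG z hz).2) hy, ← hGy]
        ring
      · rw [Complex.ofReal_im, mul_zero]
  · -- non-triviality: `ŝ ≢ 0`
    obtain ⟨x, hx⟩ := exists_gauge_ne_zero hr1 hS1 (hSpos 0) hG.continuous fun z hz => (hFG z hz).2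
    exact ⟨x, Or.inr (Complex.ofReal_ne_zero.2 hx)⟩
  · -- the eigen-identities
    intro x
    obtain ⟨h1, h2⟩ := lin_gauge_mode hW hS (fun z => (hEqs z).1) (fun z => (hEqs z).2) x
    exact ⟨h1.symm, h2.symm⟩

end Summit.AtomisticToContinuum.HydrodynamicLimit.Theorems.R2OneModeTwoConditions

end
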